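import Summits.CriticalPhenomena.PercolationContinuityZ3.Theorems.PercNearOneGluingNoHeavyLowerTailLossyPocketCoverReduction
import HarnessLib

/-!
# `NoHeavyLowerTail` (stmt-CriticalPhenomena-4575) — the FEW-PORT MISS reduction: `bad ≤ μ(o ↔ c, c small) + μ(1 ≤ |R| ≤ j, o ↮ c)`
# and the typed target FPM ⇒ crux

Bookkeeping file (engine seat `prim-cplus-engine` g5; `--supports stmt-CriticalPhenomena-4575`).  No definitions, no
named facts, no sorries.

Notation: observer `o ∉ A`, `N = |{a ∈ A : o ↔ a}|`, level `j`; the FIRST CONTACTS (ports) of `o` are the relays `a`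
joined to `o` by an open path whose interior avoids `A` (`A.filter fun a => openConnIn (insert a Aᶜ) o a`, the `R` of
the pocket decomposition `…LossyPocketPaths`).

* `LossyPocket.lowerTail_subset_fewPortMiss` — the trivial cover: on `{1 ≤ N ≤ j}` either `o ↔ c` (and then
  `|π(c)| = N ≤ j`) or `o ↮ c` and `o` has between `1` and `j` first contacts (they all lie in `o`'s cluster).  Hence
  `μ{1 ≤ N ≤ j} ≤ μ({o ↔ c} ∩ {|π(c)| ≤ j}) + FPM_j(c)`, `FPM_j(c) := μ{1 ≤ |R| ≤ j, o ↮ c}` (`lowerTail_le_fewPortMiss`).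
* `LossyPocket.lowerHalf_le_of_lowLevel` — the window arithmetic of `lowerTail_half_le_of_fewPortCover` isolated:
  ANY bound `μ{1 ≤ N ≤ ⌊k/m⌋} ≤ L` gives `μ{0 < N, 2N ≤ k} ≤ L + (4m+8)·t`.
* `noHeavyLowerTail_of_fewPortMissConst` — **FPM ⇒ crux**: if for some `m ≥ 3`, `C ≥ 0` every finite weighted graph,
  `A ∌ o` nonempty and pairwise budget `t` admit a relay `c ∈ A` with `FPM_{⌊|A|/m⌋}(c) ≤ C·(μ(o ↮ A) + t)`, then
  `NoHeavyLowerTail`.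
Engine status (memo `ENGINE-g5.md` §4): `min_c FPM_j(c) ≤ 0.52·(t + μ(o ↮ A))` on every family that refuted the lossy covers
(padded F1, F3, `G(m^L)`, the `j = k−2` corner) and under the first adversarial climbs (n ≤ 8); and
`bad ≤ LLQ(c) ≤ μ(o ↔ c, c small) + FPM_j(c)` places the signed quantitative cover between the two (§3).
-/

noncomputable section

namespace Summit.CriticalPhenomena.PercolationContinuityZ3.Theorems

open MeasureTheory Set Literature.Probability.LatticeModels Literature.Probability.Percolation
open scoped Classical BigOperators

namespace LossyPocket

variable {n : ℕ}

/-- **The trivial few-port cover.**  For `o ∉ A` and any vertex `c`: on `{1 ≤ N ≤ j}`, either `o ↔ c` and `c`'s relay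
count is `N ≤ j`, or `o ↮ c` and the first contacts of `o` — all of which lie in `o`'s cluster, and one of which exists as
soon as `o` meets `A` — number between `1` and `j`. [this work] -/
theorem lowerTail_subset_fewPortMiss (A : Finset (Fin n)) (o c : Fin n) (j : ℕ) (hoA : o ∉ A) :
    {ω : BondConfig (Fin n) |
        1 ≤ (A.filter fun x => ω ∈ openConn o x).card ∧ (A.filter fun x => ω ∈ openConn o x).card ≤ j} ⊆
      ((openConn o c : Set (BondConfig (Fin n))) ∩
          {ω : BondConfig (Fin n) | (A.filter fun x => ω ∈ openConn c x).card ≤ j}) ∪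
        {ω : BondConfig (Fin n) |
          1 ≤ (A.filter fun a => ω ∈ openConnIn (insert a ((↑A : Set (Fin n))ᶜ)) o a).card ∧
            (A.filter fun a => ω ∈ openConnIn (insert a ((↑A : Set (Fin n))ᶜ)) o a).card ≤ j ∧
            ω ∉ openConn o c} := by
  intro ω hω
  obtain ⟨h1, hj⟩ := hω
  by_cases hoc : ω ∈ openConn o c
  · left
    refine ⟨hoc, ?_⟩
    have hoc' : (openGraph ω).Reachable o c := hoc
    have heq : (A.filter fun x => ω ∈ openConn c x) = (A.filter fun x => ω ∈ openConn o x) := by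
      refine Finset.filter_congr fun x _ => ?_
      exact ⟨fun h => hoc'.trans h, fun h => hoc'.symm.trans h⟩
    show (A.filter fun x => ω ∈ openConn c x).card ≤ j
    rw [heq]; exact hj
  · right
    set W : Finset (Fin n) := Finset.univ.filter fun v => ω ∈ openConnIn ((↑A : Set (Fin n))ᶜ) o v with hW
    set N : Finset (Fin n) := A.filter fun a => ω ∈ openConnIn (insert a ((↑A : Set (Fin n))ᶜ)) o a with hN
    have hP : (Finset.univ.filter fun v => ω ∈ openConnIn ((↑A : Set (Fin n))ᶜ) o v) = W ∧
        (A.filter fun a => ω ∈ openConnIn (insert a ((↑A : Set (Fin n))ᶜ)) o a) = N := ⟨rfl, rfl⟩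
    -- the contacts lie in the cluster of `o`
    have hsub : N ⊆ A.filter fun x => ω ∈ openConn o x := by
      intro a ha
      exact Finset.mem_filter.2 ⟨(contacts_subset A o W N hP ha).1, reachable_of_mem_contacts A o W N hP ha⟩
    -- a contact exists: `o` meets some relay, which is outside the pocket
    obtain ⟨a, ha⟩ := Finset.card_pos.1 h1
    obtain ⟨haA, hoa⟩ := Finset.mem_filter.1 ha
    have haW : a ∉ W := notMem_pocket_of_mem_relays A o W N hP haA
    obtain ⟨b, hbN, -⟩ := (openConn_observer_iff A o W N hoA hP haW).1 hoa
    refine ⟨Finset.card_pos.2 ⟨b, hbN⟩, (Finset.card_le_card hsub).trans hj, hoc⟩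

/-- **`bad ≤ μ(o ↔ c, c small) + FPM_j(c)`** for `o ∉ A` and every vertex `c`, where
`FPM_j(c) = μ{1 ≤ |first contacts| ≤ j, o ↮ c}`. [this work] -/
theorem lowerTail_le_fewPortMiss (w : Sym2 (Fin n) → unitInterval) (A : Finset (Fin n)) (o c : Fin n) (j : ℕ)
    (hoA : o ∉ A) :
    (prodBernoulli w).real {ω : BondConfig (Fin n) |
        1 ≤ (A.filter fun x => ω ∈ openConn o x).card ∧ (A.filter fun x => ω ∈ openConn o x).card ≤ j} ≤
      (prodBernoulli w).real ((openConn o c : Set (BondConfig (Fin n))) ∩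
          {ω : BondConfig (Fin n) | (A.filter fun x => ω ∈ openConn c x).card ≤ j}) +
        (prodBernoulli w).real {ω : BondConfig (Fin n) |
          1 ≤ (A.filter fun a => ω ∈ openConnIn (insert a ((↑A : Set (Fin n))ᶜ)) o a).card ∧
            (A.filter fun a => ω ∈ openConnIn (insert a ((↑A : Set (Fin n))ᶜ)) o a).card ≤ j ∧
            ω ∉ openConn o c} :=
  (measureReal_mono (lowerTail_subset_fewPortMiss A o c j hoA) (measure_ne_top _ _)).trans
    (measureReal_union_le _ _)

/-- **The middle window is free.**  `o ∉ A`, `A ≠ ∅`, `m ≥ 3`, pairwise budget `t ≥ 0`: for every `L`, a bound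
`μ{1 ≤ N ≤ ⌊k/m⌋} ≤ L` at the low level implies `μ{0 < N, 2N ≤ k} ≤ L + (4m+8)·t` (`k = |A|`); the window
`⌊k/m⌋ < N ≤ k/2` is paid by pair counting (`PocketMoments.window_le_pairSum`).  (The arithmetic of
`lowerTail_half_le_of_fewPortCover`, verbatim, with the cover replaced by the hypothesis.) [this work] -/
theorem lowerHalf_le_of_lowLevel (w : Sym2 (Fin n) → unitInterval) (A : Finset (Fin n)) (o : Fin n)
    (m : ℕ) (hm : 3 ≤ m) (t L : ℝ) (ht : 0 ≤ t) (hA : A.Nonempty)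
    (hpair : ∀ a ∈ A, ∀ a' ∈ A, (prodBernoulli w).real (openConn a a' : Set (BondConfig (Fin n)))ᶜ ≤ t)
    (hlow : (prodBernoulli w).real {ω : BondConfig (Fin n) |
        1 ≤ (A.filter fun a => ω ∈ openConn o a).card ∧ (A.filter fun a => ω ∈ openConn o a).card ≤ A.card / m} ≤ L) :
    (prodBernoulli w).real {ω : BondConfig (Fin n) |
        0 < (A.filter fun a => ω ∈ openConn o a).card ∧
          2 * (A.filter fun a => ω ∈ openConn o a).card ≤ A.card} ≤ L + (4 * m + 8) * t := by
  set μ := prodBernoulli w with hμ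
  set k := A.card with hk
  set j := k / m with hj
  have hk1 : 1 ≤ k := Finset.card_pos.2 hA
  have hmr : (3 : ℝ) ≤ m := by exact_mod_cast hm
  have hkr1 : (1 : ℝ) ≤ k := by exact_mod_cast hk1
  set Nf : BondConfig (Fin n) → ℕ := fun ω => (A.filter fun a => ω ∈ openConn o a).card with hNf
  have hlow' : μ.real {ω : BondConfig (Fin n) | 1 ≤ Nf ω ∧ Nf ω ≤ j} ≤ L := by simpa only [hNf] using hlow
  -- the middle window `{j+1 ≤ N ≤ k/2}` : pair counting (free)
  have hpairs := pairSum_le_card_sq_mul w A t ht hpair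
  have hwin := PocketMoments.window_le_pairSum w A o (j + 1) (k / 2)
  have hmid : μ.real {ω : BondConfig (Fin n) | j + 1 ≤ Nf ω ∧ Nf ω ≤ k / 2} ≤ (4 * m + 8) * t := by
    by_cases hsmall : k < 2 * m
    · have hwin1 := PocketMoments.window_le_pairSum w A o 1 (k / 2)
      have hsub : {ω : BondConfig (Fin n) | j + 1 ≤ Nf ω ∧ Nf ω ≤ k / 2} ⊆
          {ω : BondConfig (Fin n) | 1 ≤ (A.filter fun a => ω ∈ openConn o a).card ∧
            (A.filter fun a => ω ∈ openConn o a).card ≤ k / 2} := fun ω hω =>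
        ⟨le_trans (Nat.succ_le_succ (Nat.zero_le j)) hω.1, hω.2⟩
      have hmono := measureReal_mono (μ := μ) hsub (measure_ne_top _ _)
      rcases Nat.lt_or_ge k 2 with hk2 | hk2
      · have hk0 : k / 2 = 0 := by omega
        have hempty : {ω : BondConfig (Fin n) | j + 1 ≤ Nf ω ∧ Nf ω ≤ k / 2} = ∅ := by
          ext ω
          simp only [mem_setOf_eq, mem_empty_iff_false, iff_false, not_and, hk0]
          intro h1 h2
          have : 1 ≤ Nf ω := le_trans (Nat.succ_le_succ (Nat.zero_le j)) h1
          omega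
        rw [hempty, measureReal_empty]; positivity
      · have hL : ((k : ℝ) - 1) ≤ min (((1 : ℕ) : ℝ) * ((A.card : ℝ) - ((1 : ℕ) : ℝ)))
            (((k / 2 : ℕ) : ℝ) * ((A.card : ℝ) - ((k / 2 : ℕ) : ℝ))) := by
          rw [le_min_iff]
          constructor
          · simp [hk]
          · have h2 : 2 * (k / 2) ≤ k := Nat.mul_div_le k 2
            have h3 : k < 2 * (k / 2) + 2 := by omega
            have hq1 : (1 : ℝ) ≤ (k / 2 : ℕ) := by exact_mod_cast (show 1 ≤ k / 2 by omega)
            have hq2 : ((k / 2 : ℕ) : ℝ) * 2 ≤ k := by exact_mod_cast (by omega : (k / 2) * 2 ≤ k)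
            have hkr : ((A.card : ℕ) : ℝ) = k := by rw [hk]
            rw [hkr]
            nlinarith
        have hkpos : (0 : ℝ) < (k : ℝ) - 1 + 1 := by linarith
        have hk1' : (1 : ℝ) ≤ (k : ℝ) - 1 := by
          have : (2 : ℝ) ≤ k := by exact_mod_cast hk2
          linarith
        have hkk : (A.card : ℝ) = k := by rw [hk]
        have e1 : ((k : ℝ) - 1) * μ.real {ω : BondConfig (Fin n) | 1 ≤ (A.filter fun a => ω ∈ openConn o a).card ∧
            (A.filter fun a => ω ∈ openConn o a).card ≤ k / 2} ≤ (k : ℝ) * k * t := by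
          have hnn : 0 ≤ μ.real {ω : BondConfig (Fin n) | 1 ≤ (A.filter fun a => ω ∈ openConn o a).card ∧
            (A.filter fun a => ω ∈ openConn o a).card ≤ k / 2} := measureReal_nonneg
          calc ((k : ℝ) - 1) * μ.real _ ≤ min (((1 : ℕ) : ℝ) * ((A.card : ℝ) - ((1 : ℕ) : ℝ)))
                (((k / 2 : ℕ) : ℝ) * ((A.card : ℝ) - ((k / 2 : ℕ) : ℝ))) * μ.real _ :=
                mul_le_mul_of_nonneg_right hL hnn
            _ ≤ _ := hwin1
            _ ≤ (A.card : ℝ) * (A.card : ℝ) * t := hpairs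
            _ = (k : ℝ) * k * t := by rw [hkk]
        have hkm : (k : ℝ) < 2 * m := by exact_mod_cast hsmall
        have e2 : (k : ℝ) * k * t ≤ ((k : ℝ) - 1) * ((4 * m + 8) * t) := by
          have hk2r : (2 : ℝ) ≤ k := by exact_mod_cast hk2
          have h := mul_le_mul_of_nonneg_right (window_arith_small (k : ℝ) m hk2r hkm) ht
          linarith [h]
        have e3 : ((k : ℝ) - 1) * μ.real {ω : BondConfig (Fin n) | j + 1 ≤ Nf ω ∧ Nf ω ≤ k / 2} ≤
            ((k : ℝ) - 1) * ((4 * m + 8) * t) :=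
          (mul_le_mul_of_nonneg_left hmono (by linarith)).trans (e1.trans e2)
        exact le_of_mul_le_mul_left e3 (by linarith)
    · have hsmall' : 2 * m ≤ k := not_lt.1 hsmall
      have hkm : (2 : ℝ) * m ≤ k := by exact_mod_cast hsmall'
      have hm0 : 0 < m := by omega
      have hj1 : (k : ℝ) ≤ m * ((j : ℝ) + 1) := by
        have h : k < m * (k / m + 1) := Nat.lt_mul_div_succ k hm0
        have h' : (k : ℝ) < m * ((j : ℝ) + 1) := by rw [hj]; exact_mod_cast h
        exact h'.le
      have hj2 : 3 * (((j : ℝ) + 1) - 1) ≤ k := by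
        have h : m * (k / m) ≤ k := Nat.mul_div_le k m
        have h' : (m : ℝ) * j ≤ k := by rw [hj]; exact_mod_cast h
        have hj0 : (0 : ℝ) ≤ j := by exact_mod_cast Nat.zero_le j
        nlinarith
      have hq2 : ((k / 2 : ℕ) : ℝ) * 2 ≤ k := by exact_mod_cast (by omega : (k / 2) * 2 ≤ k)
      have hq3 : (k : ℝ) < ((k / 2 : ℕ) : ℝ) * 2 + 2 := by
        exact_mod_cast (by omega : k < (k / 2) * 2 + 2)
      have hkk : (A.card : ℝ) = k := by rw [hk]
      have hL : (k : ℝ) * k / (2 * m + 8) ≤ min ((((j + 1 : ℕ)) : ℝ) * ((A.card : ℝ) - ((j + 1 : ℕ) : ℝ)))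
          (((k / 2 : ℕ) : ℝ) * ((A.card : ℝ) - ((k / 2 : ℕ) : ℝ))) := by
        rw [hkk, le_min_iff]
        constructor
        · have e : (((j + 1 : ℕ)) : ℝ) = (j : ℝ) + 1 := by push_cast; ring
          rw [e]
          exact window_arith_low (k : ℝ) m ((j : ℝ) + 1) hmr hkm hj1 hj2
        · exact window_arith_high (k : ℝ) m ((k / 2 : ℕ) : ℝ) hmr hkm hq2 hq3
      have hnn : 0 ≤ μ.real {ω : BondConfig (Fin n) | j + 1 ≤ Nf ω ∧ Nf ω ≤ k / 2} := measureReal_nonneg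
      have e1 : (k : ℝ) * k / (2 * m + 8) * μ.real {ω : BondConfig (Fin n) | j + 1 ≤ Nf ω ∧ Nf ω ≤ k / 2} ≤
          (k : ℝ) * k * t :=
        calc (k : ℝ) * k / (2 * m + 8) * μ.real _
            ≤ min ((((j + 1 : ℕ)) : ℝ) * ((A.card : ℝ) - ((j + 1 : ℕ) : ℝ)))
                (((k / 2 : ℕ) : ℝ) * ((A.card : ℝ) - ((k / 2 : ℕ) : ℝ))) * μ.real _ :=
              mul_le_mul_of_nonneg_right hL hnn
          _ ≤ _ := by simpa only [hNf] using hwin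
          _ ≤ (A.card : ℝ) * (A.card : ℝ) * t := hpairs
          _ = (k : ℝ) * k * t := by rw [hkk]
      have hkk0 : (0 : ℝ) < (k : ℝ) * k := by nlinarith
      have e2 : μ.real {ω : BondConfig (Fin n) | j + 1 ≤ Nf ω ∧ Nf ω ≤ k / 2} ≤ (2 * m + 8) * t := by
        have hmpos : (0 : ℝ) < 2 * m + 8 := by linarith
        have := e1
        rw [div_mul_eq_mul_div, div_le_iff₀ hmpos] at this
        nlinarith
      nlinarith
  -- assemble
  have hsplit : {ω : BondConfig (Fin n) | 0 < Nf ω ∧ 2 * Nf ω ≤ A.card} ⊆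
      {ω : BondConfig (Fin n) | 1 ≤ Nf ω ∧ Nf ω ≤ j} ∪ {ω : BondConfig (Fin n) | j + 1 ≤ Nf ω ∧ Nf ω ≤ k / 2} := by
    intro ω hω
    obtain ⟨h0, h2⟩ := hω
    by_cases hle : Nf ω ≤ j
    · exact Or.inl ⟨h0, hle⟩
    · refine Or.inr ⟨by omega, ?_⟩
      show Nf ω ≤ k / 2
      omega
  calc μ.real {ω : BondConfig (Fin n) | 0 < Nf ω ∧ 2 * Nf ω ≤ A.card}
      ≤ μ.real ({ω : BondConfig (Fin n) | 1 ≤ Nf ω ∧ Nf ω ≤ j} ∪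
          {ω : BondConfig (Fin n) | j + 1 ≤ Nf ω ∧ Nf ω ≤ k / 2}) := measureReal_mono hsplit (measure_ne_top _ _)
    _ ≤ μ.real {ω : BondConfig (Fin n) | 1 ≤ Nf ω ∧ Nf ω ≤ j} +
          μ.real {ω : BondConfig (Fin n) | j + 1 ≤ Nf ω ∧ Nf ω ≤ k / 2} := measureReal_union_le _ _
    _ ≤ L + (4 * m + 8) * t := add_le_add hlow' hmid


end LossyPocket

/-- **FPM ⇒ crux: a few-port miss bound with any constant, at any window level `|A|/m` (`m ≥ 3`), closes
`NoHeavyLowerTail`.**  If for some `m ≥ 3`, `C ≥ 0`, every finite weighted graph, every relay set `A ∌ o`, `A ≠ ∅`,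
and every pairwise budget `t` admit a relay `c ∈ A` with `μ{1 ≤ |first contacts of o| ≤ ⌊|A|/m⌋, o ↮ c} ≤ C·(μ(o ↮ A) + t)`,
then `NoHeavyLowerTail`: the trivial cover, pair counting for the witness (`Theorems.smallBlock_le_two_mul`), the free
middle window (`LossyPocket.lowerHalf_le_of_lowLevel`) and `Theorems.noHeavyLowerTail_of_fatMinorityLinear`. [this work] -/
theorem noHeavyLowerTail_of_fewPortMissConst (m : ℕ) (C : ℝ) (hm : 3 ≤ m) (hC : 0 ≤ C)
    (hfpm : ∀ (n : ℕ) (w : Sym2 (Fin n) → unitInterval) (A : Finset (Fin n)) (o : Fin n) (t : ℝ),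
      0 ≤ t → o ∉ A → A.Nonempty →
      (∀ a ∈ A, ∀ a' ∈ A, (prodBernoulli w).real (openConn a a' : Set (BondConfig (Fin n)))ᶜ ≤ t) →
      ∃ c ∈ A, (prodBernoulli w).real {ω : BondConfig (Fin n) |
          1 ≤ (A.filter fun a => ω ∈ openConnIn (insert a ((↑A : Set (Fin n))ᶜ)) o a).card ∧
            (A.filter fun a => ω ∈ openConnIn (insert a ((↑A : Set (Fin n))ᶜ)) o a).card ≤ A.card / m ∧
            ω ∉ openConn o c} ≤
        C * ((prodBernoulli w).real (⋃ a ∈ A, (openConn o a : Set (BondConfig (Fin n))))ᶜ + t)) :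
    Summit.CriticalPhenomena.PercolationContinuityZ3.Theses.PercNearOneGluing.NoHeavyLowerTail := by
  refine noHeavyLowerTail_of_fatMinorityLinear ⟨0, C + 4 * m + 10, by positivity, fun n w A o η hη hoA hpair => ?_⟩
  set μ := prodBernoulli w with hμ
  set δ₀ := μ.real (⋃ a ∈ A, (openConn o a : Set (BondConfig (Fin n))))ᶜ with hδ₀
  have hδ₀0 : 0 ≤ δ₀ := measureReal_nonneg
  rcases A.eq_empty_or_nonempty with hAe | hAne
  · have hempty : {ω : BondConfig (Fin n) |
        0 < (A.filter fun a => ω ∈ openConn o a).card ∧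
          2 * (A.filter fun a => ω ∈ openConn o a).card ≤ A.card} = ∅ := by
      ext ω; simp [hAe]
    rw [hempty, measureReal_empty]
    positivity
  · obtain ⟨c, hc, hfp⟩ := hfpm n w A o η hη hoA hAne hpair
    set j := A.card / m with hj
    have hcov := LossyPocket.lowerTail_le_fewPortMiss w A o c j hoA
    -- the witness term by pair counting
    have hwit : μ.real ((openConn o c : Set (BondConfig (Fin n))) ∩
        {ω : BondConfig (Fin n) | (A.filter fun x => ω ∈ openConn c x).card ≤ j}) ≤ 2 * η := by
      calc μ.real ((openConn o c : Set (BondConfig (Fin n))) ∩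
            {ω : BondConfig (Fin n) | (A.filter fun x => ω ∈ openConn c x).card ≤ j})
          ≤ μ.real {ω : BondConfig (Fin n) | 2 * (A.filter fun a' => ω ∈ openConn c a').card ≤ A.card} := by
            refine measureReal_mono (fun ω hω => ?_) (measure_ne_top _ _)
            have h1 : (A.filter fun x => ω ∈ openConn c x).card ≤ j := hω.2
            show 2 * (A.filter fun a' => ω ∈ openConn c a').card ≤ A.card
            have h2 : 2 * j ≤ A.card := by
              rw [hj]
              calc 2 * (A.card / m) ≤ m * (A.card / m) := Nat.mul_le_mul_right _ (by omega)
                _ ≤ A.card := Nat.mul_div_le A.card m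
            omega
        _ ≤ 2 * η := smallBlock_le_two_mul w A c η hc fun a' ha' => hpair c hc a' ha'
    have hlow : μ.real {ω : BondConfig (Fin n) |
        1 ≤ (A.filter fun a => ω ∈ openConn o a).card ∧ (A.filter fun a => ω ∈ openConn o a).card ≤ A.card / m} ≤
        2 * η + C * (δ₀ + η) := by
      rw [← hj]
      linarith [hcov, hwit, hfp]
    have half := LossyPocket.lowerHalf_le_of_lowLevel w A o m hm η (2 * η + C * (δ₀ + η)) hη hAne hpair hlow
    calc μ.real {ω : BondConfig (Fin n) |
          0 < (A.filter fun a => ω ∈ openConn o a).card ∧ 2 * (A.filter fun a => ω ∈ openConn o a).card ≤ A.card}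
        ≤ 2 * η + C * (δ₀ + η) + (4 * m + 8) * η := half
      _ ≤ (C + 4 * m + 10) * (δ₀ + η) := by nlinarith

end Summit.CriticalPhenomena.PercolationContinuityZ3.Theorems

end
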